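import Literature.RepresentationTheory.HeisenbergGroup.SymplecticMatrixTransport
import HarnessLib

/-!
# The unipotent radical of the Siegel parabolic `P_Y` in a Gram model: an element of `Sp(W, β_T)` fixing `ℓ_Y = 0 ⊕ K^ι`
# pointwise and trivial modulo `ℓ_Y` IS a transported Siegel unipotent `transportSp T (low c)`, with `c` explicit

Topic `RepresentationTheory/HeisenbergGroup`; namespace `Literature.RepresentationTheory.HeisenbergGroup.SymplecticMatrix` (that of ★
`SymplecticMatrixTransport`, whose `transportSp`, `low`, `lowLin`, `transportSp_low` this file continues). KERNEL ONLY: two small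
definitions with bodies (`shearMap`, `cOfFix`) and theorems; no named fact, no `sorry`, no instance, no notation.

Let `K` be a commutative ring with `2` invertible, `T ∈ M_ι(K)` with `det T` a unit, `W = X × X` (`X = ι → K`) with the duality
`β_T(x, y) = ⟨x, T y⟩` and alternating form `A = alt (polar β_T)`, `A((x,y),(x′,y′)) = β_T(x, y′) − β_T(x′, y)`, and `ℓ_Y = 0 ⊕ X`.
For `g ∈ Sp(W, A)` put `b_g : X →ₗ X`, `x ↦ (g (x, 0)).2` (`shearMap`) and **`c_g := T · Mat(b_g) ∈ M_ι(K)`** (`cOfFix`).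

* `lowLin_cOfFix : lowLin T c_g = b_g` (`T⁻¹ c_g = Mat b_g`); `dotProduct_cOfFix_mulVec : ⟨x, c_g x′⟩ = β_T(x, b_g x′)`;
  `alt_polar_inl_apply : A((x,0), g(x′,0)) = β_T(x, b_g x′)` whenever `(g(x′,0)).1 = x′`.
* `isSymm_cOfFix` : if `g` is trivial modulo `ℓ_Y` on `X ⊕ 0` (`(g(x,0)).1 = x`) then `c_g` is SYMMETRIC (`A(g(x,0), g(x′,0)) = A((x,0),(x′,0)) = 0`).
* **`eq_transportSp_low_of_fix`** : if moreover `g` fixes `ℓ_Y` pointwise (`g(0,y) = (0,y)`), then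
  **`g = transportSp T (low c_g)`** — `g(x, y) = g(x,0) + g(0,y) = (x, b_g x) + (0, y)` is weil-1's `unipotentSp β_T b_g`, which is
  `transportSp T (low c)` exactly when `T⁻¹ c = Mat b_g` (★ `transportSp_low`).
* `dotProduct_cOfFix_mulVec_self_eq_alt` : the second-degree function of `c_g` is intrinsic: `⟨x, c_g x⟩ = A((x,0), g(x,0))`.

In words: the unipotent radical `N_Y = {(x,y) ↦ (x, y + b x)}` of the Siegel parabolic `P_Y` is characterised inside `Sp(W)` by «fixes `ℓ_Y`
pointwise and acts trivially on `W/ℓ_Y`», and its Rao parameter `c` ([Rangarao1993] (3.8): `r(n(c))` = multiplication by `ψ(½⟨x, c x⟩)`) is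
read off the `X → Y` shear. USE (cell hodgecm-mathlib, line LD2, brick (GRP-N) «group side of the unipotent junction»): a MOVER
`E′ ∈ Sp(𝕎^𝔻_v)` with `E′ ℓ_Δ = ℓ_Y` carries every element of the unipotent radical `N_Δ` of the Siegel parabolic `P_Δ` of the doubled unitary
group (which fixes `ℓ_Δ` pointwise and is trivial mod `ℓ_Δ`) to such a `g`, whence `E′ ι(n) E′⁻¹ = transportSp 𝕋 (low c)` with `c` explicit
in `E′` — the hypothesis `hB` of ★ `leraySection_deltaLagrangian_apply_eq_conj_unipOpPi`.  HONEST LABEL: linear algebra only; HC_CM is proved only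
modulo the printed citations (2 remaining named inputs hLiu418, h413) until rung 0 closes; count-neutral.

## References
* R. Ranga Rao, Pacific J. Math. 157 (1993), §2.2 p. 338 (the Siegel parabolic `P_Y = M N`), Lemma 3.2 (3.8) p. 351 [Rangarao1993].
* A. Weil, Acta Math. 111 (1964), n° 6–7, pp. 151–152 [Weil1964].
* C. Mœglin, M.-F. Vignéras, J.-L. Waldspurger, LNM 1291 (1987), Chap. 2 II.2 [MoeglinVignerasWaldspurger1987].
-/

set_option autoImplicit false

noncomputable section

open Matrix

namespace Literature.RepresentationTheory.HeisenbergGroup.SymplecticMatrix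

variable {K : Type*} [CommRing K] {ι : Type*} [Fintype ι] [DecidableEq ι] (T : Matrix ι ι K) (hT : IsUnit T.det)

/-- **the `X → Y` shear of `g ∈ Sp(W, β_T)`**: `b_g(x) = (g (x, 0)).2`. [cite: Rangarao1993, §2.2, p. 338] -/
def shearMap (g : symplecticGroup (polar (Matrix.toLinearMap₂' K T))) : (ι → K) →ₗ[K] (ι → K) :=
  (LinearMap.snd K (ι → K) (ι → K)).comp
    ((((g : symplecticGroup (polar (Matrix.toLinearMap₂' K T))) : ((ι → K) × (ι → K)) ≃ₗ[K] ((ι → K) × (ι → K))) :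
        ((ι → K) × (ι → K)) →ₗ[K] ((ι → K) × (ι → K))).comp (LinearMap.inl K (ι → K) (ι → K)))

/-- formula. [cite: Rangarao1993, §2.2, p. 338] -/
@[simp] theorem shearMap_apply (g : symplecticGroup (polar (Matrix.toLinearMap₂' K T))) (x : ι → K) :
    shearMap T g x = (((g : symplecticGroup (polar (Matrix.toLinearMap₂' K T))) :
      ((ι → K) × (ι → K)) ≃ₗ[K] ((ι → K) × (ι → K))) (x, 0)).2 := rfl

/-- **the Rao parameter `c_g := T · Mat(b_g)`** of `g` (so that `T⁻¹ c_g = Mat(b_g)`, the `X → Y` map of ★ `transportSp_low`).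
[cite: Rangarao1993, Lemma 3.2 (3.8), p. 351] -/
def cOfFix (g : symplecticGroup (polar (Matrix.toLinearMap₂' K T))) : Matrix ι ι K := T * LinearMap.toMatrix' (shearMap T g)

/-- `A((x, 0), w) = β_T(x, w.2)` — against `X ⊕ 0` the alternating form reads the `Y`-component. [cite: Weil1964, n° 5, p. 150] -/
theorem alt_polar_inl_apply (x : ι → K) (w : (ι → K) × (ι → K)) :
    alt (polar (Matrix.toLinearMap₂' K T)) (x, 0) w = Matrix.toLinearMap₂' K T x w.2 := by
  rw [alt_apply, polar_apply, polar_apply, map_zero, sub_zero]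

/-- `⟨x, c_g x′⟩ = β_T(x, b_g x′)`. [cite: Rangarao1993, Lemma 3.2 (3.8), p. 351] -/
theorem dotProduct_cOfFix_mulVec (g : symplecticGroup (polar (Matrix.toLinearMap₂' K T))) (x x' : ι → K) :
    x ⬝ᵥ cOfFix T g *ᵥ x' = Matrix.toLinearMap₂' K T x (shearMap T g x') := by
  rw [cOfFix, ← Matrix.mulVec_mulVec, LinearMap.toMatrix'_mulVec, Matrix.toLinearMap₂'_apply']

/-- **the second-degree function of `c_g` is intrinsic**: `⟨x, c_g x⟩ = A((x, 0), g (x, 0))`. [cite: Rangarao1993, Lemma 3.2 (3.8), p. 351] -/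
theorem dotProduct_cOfFix_mulVec_self_eq_alt (g : symplecticGroup (polar (Matrix.toLinearMap₂' K T))) (x x' : ι → K) :
    x ⬝ᵥ cOfFix T g *ᵥ x' = alt (polar (Matrix.toLinearMap₂' K T)) (x, 0)
      (((g : symplecticGroup (polar (Matrix.toLinearMap₂' K T))) : ((ι → K) × (ι → K)) ≃ₗ[K] ((ι → K) × (ι → K))) (x', 0)) := by
  rw [dotProduct_cOfFix_mulVec, alt_polar_inl_apply, shearMap_apply]

include hT in
/-- `T⁻¹ c_g = Mat(b_g)`: the `X → Y` map of `transportSp T (low c_g)` is the shear `b_g` (★ `lowLin`). [cite: Rangarao1993, §2.2, p. 338] -/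
theorem lowLin_cOfFix (g : symplecticGroup (polar (Matrix.toLinearMap₂' K T))) : lowLin T (cOfFix T g) = shearMap T g := by
  apply LinearMap.ext
  intro x
  rw [lowLin_apply, cOfFix, Matrix.nonsing_inv_mul_cancel_left T _ hT, LinearMap.toMatrix'_mulVec]

/-- **`c_g` is symmetric** as soon as `g` is trivial modulo `ℓ_Y` on `X ⊕ 0`: `A(g(x,0), g(x′,0)) = A((x,0),(x′,0)) = 0` reads
`β_T(x, b_g x′) = β_T(x′, b_g x)`. [cite: Rangarao1993, §2.2, p. 338; Weil1964, n° 6, p. 151] -/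
theorem isSymm_cOfFix (g : symplecticGroup (polar (Matrix.toLinearMap₂' K T)))
    (h₂ : ∀ x : ι → K, ((((g : symplecticGroup (polar (Matrix.toLinearMap₂' K T))) :
      ((ι → K) × (ι → K)) ≃ₗ[K] ((ι → K) × (ι → K))) (x, 0)).1) = x) :
    (cOfFix T g).IsSymm := by
  -- the bilinear identity `⟨x, c x′⟩ = ⟨x′, c x⟩`
  have key : ∀ x x' : ι → K, x ⬝ᵥ cOfFix T g *ᵥ x' = x' ⬝ᵥ cOfFix T g *ᵥ x := by
    intro x x'
    have hg := (Heisenberg.PseudoSymplectic.mem_isometries _ _).1 g.2 (x, 0) (x', 0)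
    rw [alt_apply, alt_apply, polar_apply, polar_apply, polar_apply, polar_apply, h₂ x, h₂ x'] at hg
    simp only [map_zero, sub_self] at hg
    rw [dotProduct_cOfFix_mulVec, dotProduct_cOfFix_mulVec, shearMap_apply, shearMap_apply]
    exact sub_eq_zero.1 hg
  refine Matrix.IsSymm.ext fun i j => ?_
  have h := key (Pi.single j 1) (Pi.single i 1)
  simpa only [single_one_dotProduct, Matrix.mulVec_single_one, Matrix.col_apply] using h

/-- **THE UNIPOTENT RADICAL OF `P_Y` INSIDE `Sp(W, β_T)`**: an element `g` fixing `ℓ_Y = 0 ⊕ X` pointwise (`g(0,y) = (0,y)`) and trivial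
modulo `ℓ_Y` (`(g(x,0)).1 = x`) IS the transported Siegel unipotent `transportSp T (low c_g)`, `c_g = T · Mat(x ↦ (g(x,0)).2)` symmetric:
`g(x, y) = (x, y + b_g x)`. [cite: Rangarao1993, §2.2, p. 338, Lemma 3.2 (3.8), p. 351; Weil1964, n° 6–7, pp. 151–152] -/
theorem eq_transportSp_low_of_fix [Invertible (2 : K)] (g : symplecticGroup (polar (Matrix.toLinearMap₂' K T)))
    (h₁ : ∀ y : ι → K, (((g : symplecticGroup (polar (Matrix.toLinearMap₂' K T))) :
      ((ι → K) × (ι → K)) ≃ₗ[K] ((ι → K) × (ι → K))) (0, y)) = (0, y))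
    (h₂ : ∀ x : ι → K, ((((g : symplecticGroup (polar (Matrix.toLinearMap₂' K T))) :
      ((ι → K) × (ι → K)) ≃ₗ[K] ((ι → K) × (ι → K))) (x, 0)).1) = x) :
    g = transportSp T hT (low (cOfFix T g) (isSymm_cOfFix T g h₂)) := by
  apply Subtype.ext
  apply LinearEquiv.ext
  rintro ⟨x, y⟩
  have hsplit : (((g : symplecticGroup (polar (Matrix.toLinearMap₂' K T))) : ((ι → K) × (ι → K)) ≃ₗ[K] ((ι → K) × (ι → K))) (x, y)) =
      (((g : symplecticGroup (polar (Matrix.toLinearMap₂' K T))) : ((ι → K) × (ι → K)) ≃ₗ[K] ((ι → K) × (ι → K))) (x, 0)) + (0, y) := by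
    conv_rhs => rw [← h₁ y, ← map_add, Prod.mk_add_mk, add_zero, zero_add]
  rw [hsplit, transportSp_low T hT, coe_unipotentSp, unipotentσ_apply, lowLin_cOfFix T hT g, shearMap_apply]
  refine Prod.ext ?_ ?_
  · simp only [Prod.fst_add, h₂ x, add_zero]
  · simp only [Prod.snd_add]
    exact add_comm _ _

end Literature.RepresentationTheory.HeisenbergGroup.SymplecticMatrix

end
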